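import Summits.BirchSwinnertonDyer.BirchSwinnertonDyer.Theorems.ThetaPartnerAtTwoSignedControlAtTwoPlusHondaTransportEngine
import Literature.NumberTheory.EllipticCurves.Rank1Residual.Predicates
import Mathlib.NumberTheory.Padics.HeightOneSpectrum
import HarnessLib

/-!
# Model transport for the plus Honda system at `2` (HONDA⁺@2, K4 `SignedControlAtTwo`, stmt-BirchSwinnertonDyer-20309, line
# `eulerchar` v6 stub `stub_plusHondaSystemTwo`) — file 2 of 2: from Mathlib's `ℚ_[2]` (the currency of the K3 lead's local theory
# at `2`, every embedding `ι`) to the completion `ℚ_v = v.adicCompletion ℚ` with the chosen embedding `closureEmb ℚ_v` (the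
# currency of the stub)

Route `ThetaPartnerAtTwo` (TP2; crux shared with RTT), crux K4, line `eulerchar` v6 (8d2b4be25f391f24, lead
`prover-bsd-wall-tp2-p3` g2); seat `prover-bsd-wall-tp2-p3-w3` (width seat 3/3). Engine: file 1 (`…PlusHondaTransportEngine`).

WHAT.
* §3 `hondaSystem_modelTransport` (any `K`, `K`-fields `E ≃ E'` under `Φ : Ē ≃ₐ[K] Ē'` over `φ : E ≃+* E'`, embeddings
  `ι' = Φ ∘ ι`, coordinate map `T = Φ_*` given by `hT`, any `ℤ_p`-extension `κ`, any multiplier `q`): a Honda system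
  `(L) ∧ (TR) ∧ (GEN) ∧ (GEN₀)` — the four clauses of `stub_plusHondaSystemTwo`: layer membership, the trace relation
  `Tr_{m+2/m+1} d_{m+2} = −d_m`, `ℤ[Γ]`-generation modulo the previous layer and `q`, generation of the bottom layer modulo `q` —
  over (`E`, `ι`) yields one over (`E'`, `ι'`), namely `T ∘ d` (file 1: layer points, traces, orbit closures correspond).
* §4 `K = ℚ`: **`plusHondaSystem_adicCompletion_of_padic`** — for `W/ℚ`, a `ℤ_p`-extension `κ` and the place `v ∋ p`: if the
  Honda system exists over `ℚ_[p]` for EVERY embedding `ι : ℚ̄ → ℚ̄_p`, then it exists over `ℚ_v` for `closureEmb ℚ_v` — at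
  `p = 2` literally the body of `stub_plusHondaSystemTwo` at (`W`, `κ`, `v`) (Mathlib's `adicCompletion.padicEquiv v : ℚ_v ≃ ℚ_[p]`,
  `IsAlgClosure.equivOfEquiv`, `ι := Φ⁻¹ ∘ closureEmb`); and the sub-row form **`stub_plusHondaSystemTwo_of_padic`** whose
  conclusion is the registered v6 signature VERBATIM. So the K3/K4 construction of HONDA⁺@2 may be finished entirely in the
  `ℚ_[2]` currency of `Theorems/ThetaPartnerAtTwoSignedKatoUpToAtTwoLocal*.lean`, for all `ι`.

HONEST FRAMING: THEOREMS ONLY (no definition, no named fact, no instance, no `sorry`), route-independent (no `Theses` import);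
Galois-theoretic bookkeeping; closes nothing by itself (both sides are the stub's body); BSD is not proved by any of this.

References: [SerreGaloisCohomology1997] J.-P. Serre, *Galois Cohomology*, I.§2.4, II.§1.1; [Kobayashi2003] S. Kobayashi,
Invent. Math. 152 (2003), Def. 1.1, §8.4 (Lemma 8.9, Prop. 8.11, Prop. 8.12); [MilneFT2022] J. S. Milne, *Fields and Galois
Theory*, Ch. 6 (uniqueness of algebraic closures); [SilvermanAEC2009] VIII.§1, X.§4.
-/

set_option autoImplicit false
-- the Theorems namespace of this sub repeats the summit name by design (D-0017 nested layout)
set_option linter.dupNamespace false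

noncomputable section

open scoped Classical NumberField

open NumberField IsDedekindDomain WeierstrassCurve Literature.NumberTheory.EllipticCurves
  Literature.NumberTheory.EllipticCurves.Kobayashi2003
  Summit.BirchSwinnertonDyer.Rank1Residual.Additive.LocalTransport

universe u

namespace Summit.BirchSwinnertonDyer.BirchSwinnertonDyer.Theorems.SignedEC

section Generic

variable {K : Type u} [Field K] {E : Type u} [Field E] [Algebra K E] {E' : Type u} [Field E'] [Algebra K E']
  (Φ : AlgebraicClosure E ≃ₐ[K] AlgebraicClosure E') (φ : E ≃+* E')
  (hf : ∀ y : E, Φ (algebraMap E (AlgebraicClosure E) y) = algebraMap E' (AlgebraicClosure E') (φ y))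
  (ι : AlgebraicClosure K →ₐ[K] AlgebraicClosure E) (ι' : AlgebraicClosure K →ₐ[K] AlgebraicClosure E')
  (hcompat : ∀ z : AlgebraicClosure K, ι' z = Φ (ι z))
  (W : WeierstrassCurve K) (T : localPoints W E →+ localPoints W E')
  (hT : ∀ P : localPoints W E, T P =
    WeierstrassCurve.Affine.Point.map (W' := W) (Φ : AlgebraicClosure E →ₐ[K] AlgebraicClosure E')
      (show (W.baseChange (AlgebraicClosure E)).toAffine.Point from P))
  {p : ℕ} [Fact p.Prime] (κ : ZpExtension K p)

/-! ## §3 Transport of a Honda system -/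

include hf hcompat hT in
/-- **A Honda system over (`E`, `ι`) yields a Honda system over (`E'`, `ι'`)** — the four clauses (L) layer membership, (TR) the
trace relation `Tr_{m+2/m+1} d_{m+2} = −d_m`, (GEN) `ℤ[Γ]`-generation modulo the previous layer and `q`, (GEN₀) generation of the
bottom layer modulo `q`, for `d' := T ∘ d` (§2: layer points, traces and orbit closures correspond under the bijection `T`).
[cite: Kobayashi2003, Def. 1.1, §8.4] [cite: SerreGaloisCohomology1997, II.§1.1] -/
theorem hondaSystem_modelTransport (q : ℕ)
    (h : ∃ d : ℕ → localPoints W E,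
      (∀ m, d m ∈ localLayerPointsOfEmb κ ι W m) ∧
      (∀ m, localTraceOfEmb κ ι W (m + 1) (m + 2) (d (m + 2)) = -d m) ∧
      (∀ m : ℕ, 1 ≤ m → ∀ P ∈ localLayerPointsOfEmb κ ι W m,
        ∃ B ∈ AddSubgroup.closure (Set.range fun σ : Field.absoluteGaloisGroup E ↦ σ • d m),
          ∃ P' ∈ localLayerPointsOfEmb κ ι W (m - 1),
          ∃ R ∈ localLayerPointsOfEmb κ ι W m, P = B + P' + q • R) ∧
      (∀ P ∈ localLayerPointsOfEmb κ ι W 0,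
        ∃ a : ℤ, ∃ R ∈ localLayerPointsOfEmb κ ι W 0, P = a • d 0 + q • R)) :
    ∃ d : ℕ → localPoints W E',
      (∀ m, d m ∈ localLayerPointsOfEmb κ ι' W m) ∧
      (∀ m, localTraceOfEmb κ ι' W (m + 1) (m + 2) (d (m + 2)) = -d m) ∧
      (∀ m : ℕ, 1 ≤ m → ∀ P ∈ localLayerPointsOfEmb κ ι' W m,
        ∃ B ∈ AddSubgroup.closure (Set.range fun σ : Field.absoluteGaloisGroup E' ↦ σ • d m),
          ∃ P' ∈ localLayerPointsOfEmb κ ι' W (m - 1),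
          ∃ R ∈ localLayerPointsOfEmb κ ι' W m, P = B + P' + q • R) ∧
      (∀ P ∈ localLayerPointsOfEmb κ ι' W 0,
        ∃ a : ℤ, ∃ R ∈ localLayerPointsOfEmb κ ι' W 0, P = a • d 0 + q • R) := by
  have hmem := modelMap_mem_localLayerPointsOfEmb_iff Φ φ hf ι ι' hcompat W T hT κ
  obtain ⟨d, hd, htr, hgen, hgen0⟩ := h
  refine ⟨fun m ↦ T (d m), fun m ↦ (hmem m _).mpr (hd m), fun m ↦ ?_, fun m hm P' hP' ↦ ?_, fun P' hP' ↦ ?_⟩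
  · rw [← modelMap_localTraceOfEmb Φ φ hf ι ι' hcompat W T hT κ (m + 1) (m + 2) (hd (m + 2)), htr, map_neg]
  · obtain ⟨P, rfl⟩ := modelMap_surjective Φ W T hT P'
    obtain ⟨B, hB, P₁, hP₁, R, hR, hPe⟩ := hgen m hm P ((hmem m P).mp hP')
    refine ⟨T B, ?_, T P₁, (hmem _ _).mpr hP₁, T R, (hmem _ _).mpr hR, by rw [hPe, map_add, map_add, map_nsmul]⟩
    rw [← map_modelMap_closure_orbit Φ φ hf W T hT]
    exact AddSubgroup.mem_map_of_mem T hB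
  · obtain ⟨P, rfl⟩ := modelMap_surjective Φ W T hT P'
    obtain ⟨a, R, hR, hPe⟩ := hgen0 P ((hmem 0 P).mp hP')
    exact ⟨a, T R, (hmem _ _).mpr hR, by rw [hPe, map_add, map_zsmul, map_nsmul]⟩

end Generic

/-! ## §4 `K = ℚ`: from Mathlib's `ℚ_[p]` (every embedding) to `ℚ_v` (the chosen embedding) -/

section Padic

open Rat.HeightOneSpectrum

/-- A finite place `v` of `ℚ` containing the rational prime `p` is the place of `p` (`primesEquiv v = p`). [folklore] -/
private theorem coe_primesEquiv_eq_of_natCast_mem_aux {p : ℕ} [hp : Fact p.Prime] {v : HeightOneSpectrum (𝓞 ℚ)}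
    (hpv : (p : 𝓞 ℚ) ∈ v.asIdeal) : ((primesEquiv v : Nat.Primes) : ℕ) = p := by
  have h : natGenerator v ∣ p := by
    rw [natGenerator_dvd_iff, ← map_natCast (Rat.IsIntegralClosure.intEquiv (𝓞 ℚ)) p]
    exact Ideal.mem_map_of_mem _ hpv
  exact (Nat.prime_dvd_prime_iff_eq (prime_natGenerator v) hp.out).mp h

/-- `ℚ_[p] ≃ ℚ_v` as `ℚ`-algebras at the place `v ∋ p` (Mathlib's `adicCompletion.padicEquiv`). [folklore] -/
private theorem nonempty_algEquiv_padic_adicCompletion_aux {p : ℕ} [Fact p.Prime] {v : HeightOneSpectrum (𝓞 ℚ)}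
    (hpv : (p : 𝓞 ℚ) ∈ v.asIdeal) : Nonempty (ℚ_[p] ≃ₐ[ℚ] v.adicCompletion ℚ) := by
  obtain rfl : ((primesEquiv v : Nat.Primes) : ℕ) = p := coe_primesEquiv_eq_of_natCast_mem_aux hpv
  exact ⟨(adicCompletion.padicEquiv v).toAlgEquiv.symm⟩

/-- **HONDA over (`ℚ_[p]`, every `ι`) ⟹ HONDA over (`ℚ_v`, `closureEmb`)**: for `W/ℚ`, a `ℤ_p`-extension `κ` and the place
`v ∋ p`, if for EVERY embedding `ι : ℚ̄ → ℚ̄_p` (Mathlib's `ℚ_[p]`) there is a Honda system `(L) ∧ (TR) ∧ (GEN) ∧ (GEN₀)` over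
`ℚ_[p]`, then there is one over the completion `ℚ_v = v.adicCompletion ℚ` for the chosen embedding `closureEmb ℚ_v` — at
`p = 2` literally the body of the v6 stub `stub_plusHondaSystemTwo` at (`W`, `κ`, `v`). Proof: `Φ : ℚ̄_p ≃ ℚ̄_v` over Mathlib's
`padicEquiv v` (`IsAlgClosure.equivOfEquiv`), `ι := Φ⁻¹ ∘ closureEmb`, and §3 with `T = Φ_*`.
[cite: Kobayashi2003, Def. 1.1, §8.4] [cite: SerreGaloisCohomology1997, II.§1.1] [cite: MilneFT2022, Ch. 6] -/
theorem plusHondaSystem_adicCompletion_of_padic {p : ℕ} [Fact p.Prime] (W : WeierstrassCurve ℚ) (κ : ZpExtension ℚ p)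
    (v : HeightOneSpectrum (𝓞 ℚ)) (hv : (p : 𝓞 ℚ) ∈ v.asIdeal)
    (h : ∀ ι : AlgebraicClosure ℚ →ₐ[ℚ] AlgebraicClosure ℚ_[p], ∃ d : ℕ → localPoints W ℚ_[p],
      (∀ m, d m ∈ localLayerPointsOfEmb κ ι W m) ∧
      (∀ m, localTraceOfEmb κ ι W (m + 1) (m + 2) (d (m + 2)) = -d m) ∧
      (∀ m : ℕ, 1 ≤ m → ∀ P ∈ localLayerPointsOfEmb κ ι W m,
        ∃ B ∈ AddSubgroup.closure (Set.range fun σ : Field.absoluteGaloisGroup ℚ_[p] ↦ σ • d m),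
          ∃ P' ∈ localLayerPointsOfEmb κ ι W (m - 1),
          ∃ R ∈ localLayerPointsOfEmb κ ι W m, P = B + P' + p • R) ∧
      (∀ P ∈ localLayerPointsOfEmb κ ι W 0,
        ∃ a : ℤ, ∃ R ∈ localLayerPointsOfEmb κ ι W 0, P = a • d 0 + p • R)) :
    ∃ d : ℕ → localPoints W (v.adicCompletion ℚ),
      (∀ m, d m ∈ localLayerPointsOfEmb κ (closureEmb (K := ℚ) (v.adicCompletion ℚ)) W m) ∧
      (∀ m, localTraceOfEmb κ (closureEmb (K := ℚ) (v.adicCompletion ℚ)) W (m + 1) (m + 2) (d (m + 2)) = -d m) ∧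
      (∀ m : ℕ, 1 ≤ m → ∀ P ∈ localLayerPointsOfEmb κ (closureEmb (K := ℚ) (v.adicCompletion ℚ)) W m,
        ∃ B ∈ AddSubgroup.closure (Set.range fun σ : Field.absoluteGaloisGroup (v.adicCompletion ℚ) ↦ σ • d m),
          ∃ P' ∈ localLayerPointsOfEmb κ (closureEmb (K := ℚ) (v.adicCompletion ℚ)) W (m - 1),
          ∃ R ∈ localLayerPointsOfEmb κ (closureEmb (K := ℚ) (v.adicCompletion ℚ)) W m, P = B + P' + p • R) ∧
      (∀ P ∈ localLayerPointsOfEmb κ (closureEmb (K := ℚ) (v.adicCompletion ℚ)) W 0,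
        ∃ a : ℤ, ∃ R ∈ localLayerPointsOfEmb κ (closureEmb (K := ℚ) (v.adicCompletion ℚ)) W 0, P = a • d 0 + p • R) := by
  obtain ⟨e⟩ := nonempty_algEquiv_padic_adicCompletion_aux (p := p) hv
  -- `Φ : ℚ̄_p ≃ ℚ̄_v` over `e`
  let Φr : AlgebraicClosure ℚ_[p] ≃+* AlgebraicClosure (v.adicCompletion ℚ) :=
    IsAlgClosure.equivOfEquiv (AlgebraicClosure ℚ_[p]) (AlgebraicClosure (v.adicCompletion ℚ)) e.toRingEquiv
  have hf : ∀ y : ℚ_[p], Φr (algebraMap ℚ_[p] (AlgebraicClosure ℚ_[p]) y) =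
      algebraMap (v.adicCompletion ℚ) (AlgebraicClosure (v.adicCompletion ℚ)) (e.toRingEquiv y) :=
    fun y ↦ IsAlgClosure.equivOfEquiv_algebraMap _ _ e.toRingEquiv y
  have hK : ∀ c : ℚ, Φr (algebraMap ℚ (AlgebraicClosure ℚ_[p]) c) = algebraMap ℚ (AlgebraicClosure (v.adicCompletion ℚ)) c := by
    intro c
    rw [eq_ratCast (algebraMap ℚ (AlgebraicClosure ℚ_[p])), eq_ratCast (algebraMap ℚ _), map_ratCast]
  let Φ : AlgebraicClosure ℚ_[p] ≃ₐ[ℚ] AlgebraicClosure (v.adicCompletion ℚ) := { Φr with commutes' := hK }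
  have hΦ : ∀ x, Φ x = Φr x := fun _ ↦ rfl
  have hf' : ∀ y : ℚ_[p], Φ (algebraMap ℚ_[p] (AlgebraicClosure ℚ_[p]) y) =
      algebraMap (v.adicCompletion ℚ) (AlgebraicClosure (v.adicCompletion ℚ)) (e.toRingEquiv y) := fun y ↦ by
    rw [hΦ, hf]
  -- `ι := Φ⁻¹ ∘ closureEmb`
  let ι : AlgebraicClosure ℚ →ₐ[ℚ] AlgebraicClosure ℚ_[p] :=
    ((Φ.symm : AlgebraicClosure (v.adicCompletion ℚ) ≃ₐ[ℚ] AlgebraicClosure ℚ_[p]) :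
      AlgebraicClosure (v.adicCompletion ℚ) →ₐ[ℚ] AlgebraicClosure ℚ_[p]).comp (closureEmb (K := ℚ) (v.adicCompletion ℚ))
  have hcompat : ∀ z, closureEmb (K := ℚ) (v.adicCompletion ℚ) z = Φ (ι z) := fun z ↦ by
    exact (Φ.apply_symm_apply _).symm
  exact hondaSystem_modelTransport Φ e.toRingEquiv hf' ι (closureEmb (K := ℚ) (v.adicCompletion ℚ)) hcompat W
    (show localPoints W ℚ_[p] →+ localPoints W (v.adicCompletion ℚ) from
      WeierstrassCurve.Affine.Point.map (W' := W) (Φ : AlgebraicClosure ℚ_[p] →ₐ[ℚ] AlgebraicClosure (v.adicCompletion ℚ)))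
    (fun _ ↦ rfl) κ p (h ι)

/-- **The v6 stub `stub_plusHondaSystemTwo` (HONDA⁺@2 over `ℚ_v`, `closureEmb`) over the sub-row ⟸ the same Honda system over
Mathlib's `ℚ_[2]` for EVERY embedding `ι : ℚ̄ → ℚ̄₂`** — the conclusion is the registered signature VERBATIM, so the K3/K4
construction may be finished entirely in the `ℚ_[2]` currency of `Theorems/ThetaPartnerAtTwoSignedKatoUpToAtTwoLocal*.lean`.
[cite: Kobayashi2003, §8.4 (Lemma 8.9, Prop. 8.11, Prop. 8.12)] [cite: SerreGaloisCohomology1997, II.§1.1] -/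
theorem stub_plusHondaSystemTwo_of_padic
    (h : ∀ (W : WeierstrassCurve ℚ) [W.IsElliptic] [W.IsGloballyMinimal],
      ¬ W.HasCM → W.analyticRank = 0 → Rank1Residual.GoodSS W 2 → W.frobeniusTrace 2 = 0 →
      ∀ (κ : ZpExtension ℚ 2), κ.IsCyclotomic →
      ∀ ι : AlgebraicClosure ℚ →ₐ[ℚ] AlgebraicClosure ℚ_[2], ∃ d : ℕ → localPoints W ℚ_[2],
        (∀ m, d m ∈ localLayerPointsOfEmb κ ι W m) ∧
        (∀ m, localTraceOfEmb κ ι W (m + 1) (m + 2) (d (m + 2)) = -d m) ∧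
        (∀ m : ℕ, 1 ≤ m → ∀ P ∈ localLayerPointsOfEmb κ ι W m,
          ∃ B ∈ AddSubgroup.closure (Set.range fun σ : Field.absoluteGaloisGroup ℚ_[2] ↦ σ • d m),
            ∃ P' ∈ localLayerPointsOfEmb κ ι W (m - 1),
            ∃ R ∈ localLayerPointsOfEmb κ ι W m, P = B + P' + 2 • R) ∧
        (∀ P ∈ localLayerPointsOfEmb κ ι W 0,
          ∃ a : ℤ, ∃ R ∈ localLayerPointsOfEmb κ ι W 0, P = a • d 0 + 2 • R)) :
    ∀ (W : WeierstrassCurve ℚ) [W.IsElliptic] [W.IsGloballyMinimal],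
      ¬ W.HasCM → W.analyticRank = 0 → Rank1Residual.GoodSS W 2 → W.frobeniusTrace 2 = 0 →
      ∀ (κ : ZpExtension ℚ 2), κ.IsCyclotomic →
      ∀ (v : HeightOneSpectrum (𝓞 ℚ)), (2 : 𝓞 ℚ) ∈ v.asIdeal →
      ∃ d : ℕ → localPoints W (v.adicCompletion ℚ),
        (∀ m, d m ∈ localLayerPointsOfEmb κ (closureEmb (K := ℚ) (v.adicCompletion ℚ)) W m) ∧
        (∀ m, localTraceOfEmb κ (closureEmb (K := ℚ) (v.adicCompletion ℚ)) W (m + 1) (m + 2) (d (m + 2)) = -d m) ∧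
        (∀ m : ℕ, 1 ≤ m → ∀ P ∈ localLayerPointsOfEmb κ (closureEmb (K := ℚ) (v.adicCompletion ℚ)) W m,
          ∃ B ∈ AddSubgroup.closure (Set.range fun σ : Field.absoluteGaloisGroup (v.adicCompletion ℚ) ↦ σ • d m),
            ∃ P' ∈ localLayerPointsOfEmb κ (closureEmb (K := ℚ) (v.adicCompletion ℚ)) W (m - 1),
            ∃ R ∈ localLayerPointsOfEmb κ (closureEmb (K := ℚ) (v.adicCompletion ℚ)) W m, P = B + P' + 2 • R) ∧
        (∀ P ∈ localLayerPointsOfEmb κ (closureEmb (K := ℚ) (v.adicCompletion ℚ)) W 0,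
          ∃ a : ℤ, ∃ R ∈ localLayerPointsOfEmb κ (closureEmb (K := ℚ) (v.adicCompletion ℚ)) W 0, P = a • d 0 + 2 • R) :=
  fun W _ _ hcm hr hss ha κ hκ v hv ↦
    plusHondaSystem_adicCompletion_of_padic W κ v (by exact_mod_cast hv) (h W hcm hr hss ha κ hκ)

end Padic

end Summit.BirchSwinnertonDyer.BirchSwinnertonDyer.Theorems.SignedEC

end
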